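import Summits.QuantumFields.BalabanUV.T4Continuum.Support.ShellMeasureLiveEndOneCallUnionLevelsCfLin
import Summits.QuantumFields.BalabanUV.T4Continuum.Support.ShellMeasureLiveEndOneCallUnionLevelsToy
import Summits.QuantumFields.BalabanUV.T4Continuum.Support.ShellMeasureLiveEndOneCallUnionLevelsCfLinToyNumbers

/-!
# `T4Continuum.ShellMeasureLiveEndOneCallUnionLevelsCfLinToy` — row S106, file 2: RULE G-1 FOR THE ONE CALL OF RECORD v3 WITH (P4) ∧ (T1)
# LIVE — S105 f3⁗ `ShellMeasureLiveEndOneCallUnionLevelsCfLin.shellWeightBound_live_oneCall_union_levels_cfB7_lin` FIRED BY NAME, EVERY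
# BINDER SUPPLIED: two runs at two scales (`η = 1`, `½`), per comparison index a GIBBS slot ⊔ a BACKGROUND-MEDIATED slot whose (T1) tuple
# is leaf-02's block field space (`hW := blockW_prop4Hyp`, `𝒢 := 𝒢L ≠ 0`) and whose coarse-datum map `TΦ` is LINEAR with R10's `hTb` MET
(cell `pub-balaban`, sub-cell `t4`, spine estimate NE7c (node U5b); NE7c ROUND-2 crew, unit `b2b-balaban-t4-ne7c-formalise-leaf-10` gen 13;
owner table `t4/b2b-balaban-t4-ne7c-p1/LEAVES-NE7c-P1.md` row **S106** «G-1 FOR THE ONE CALL v3 WITH (P4) ∧ (T1) LIVE» (crew-referee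
C-t4r2-374; BOOKED to this lineage R-ne7cp1-g36-8 (B), GO R-ne7cp1-g36-9∕-10 after S105 ✓ + S104 f3 ✓); ADDITIVE — imports S105 f3⁗
`ShellMeasureLiveEndOneCallUnionLevelsCfLin` (p237431, leaf-09-g13: THE ONE CALL OF RECORD v3), this lineage's S96 f3
`ShellMeasureLiveEndOneCallUnionLevelsToy` (Gibbs-leg suppliers; through it S96 f2's `gibbs_sm`∕`gibbs_rad`, S89, S88) and file 1
`ShellMeasureLiveEndOneCallUnionLevelsCfLinToyNumbers` (numbers + per-scale (T1) supplies; through it leaf-02-g11's S104 f3 numbers, S77 f8's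
block space, leaf-03's S80 f7 corner datum) ONLY; [folklore]; ONE theorem, 0 `def`, 0 `def … : Prop`, 0 sorry, 0 citation tags;
default heartbeats)

HONEST FRAMING.  A TOY: a CONSISTENCY CERTIFICATE of the hypothesis list of THE ONE CALL OF RECORD v3 — nothing about Bałaban's
minimiser, propagators, kernels, densities or counts.  Finite four-torus programme, rung (B)+1 only — NOT infinite volume, NOT a mass gap,
NOT the Clay problem, NOT summit progress; NE7c (`T4IndicatorShell.ShellWeightBound` for the cell's expansions) NOT PRINTED, NOT PROVED;
«NE7c ⇐ the named binders» (c3); `ShellWeightBound` on a toy ≠ NE7c.  HONEST DEPENDENCY (cell): continuum YM on T⁴ ⇐ BetaPertH ∧ nine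
spine estimates (0/9 proved); BetaPertH ⇐ (D1) ∧ (D4) ∧ CAP+tail; G-an2-4 gates asym, D1 and NE2/3/4.

THE SCHEME (**`shellWeightBound_live_oneCall_union_levels_cfB7_lin_toy`**).  S96 f3's two-run two-scale union skeleton (`σ₀ := σ₁ := Unit`,
torus `toyParams` (`d = 2`), lattice level `0`, `η true ≡ 1`, `η false ≡ ½`), the BACKGROUND-MEDIATED slot = leaf-02-g11's S104 f3 datum
made into families: block `{b₀ 0 i₀ i₁}` of leaf-03's S80 f7 corner datum (density `toyF7 0 h01 (S∕3)`, variable `toyU (p₀ 0 i₀ i₁ h01)`,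
co-test `toyJco7`, γ3 readings `hcore_toy`∕`hcollar_toy`, core radius `a := S∕3`), (T1) ON THE BLOCK FIELD SPACE per run — `𝒴 := 𝕐 2 η_r`,
`𝒵 := 𝕎 2`, `W𝒱 := blockW 2 η_r`, **`hW := blockW_prop4Hyp`**, **`𝒢 := 𝒢L 2 η_r (B₀η_r∕2) ≠ 0`**, `H₁ := (B₀η_r∕6)•embOf c₀ readOut7`,
**`TΦ := (6∕(η_rB₀))•id`** with `hTb` MET at ONE polydisc radius `rΦ := t∕768` (`t := tS d L`), `𝔸 := ℂ`, empty stencils (the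
located-regularity rows `h52locw h52loce hreache` VACUOUS — said so), `k := 0`, `Ubg := 1`, `α₀ := α₀S d L` (α₀-rows GENUINE), number rows
by leaf-02's `row_*` lemmas, (T2)∕(T3)∕(S78) degenerate-but-legal; the ONE CALL's level-blind single letters chosen RUN-UNIFORMLY
(`B₀ = 1∕(C₄c 2+1)`, `ε₄ = t∕32`, `ε₁ = t(C₄c 2+1)∕64`, `c₁ = 4·ampT`, `c₂ = 2·ampT`, `zs = 1`) so that the η-indexed Stokes rows hold at
BOTH scales and (SM) holds WITH EQUALITY at the shared threshold profile `ε r a := θ := εθ₃ 2 d L S ½`; the GIBBS slot = S1's face on the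
side-2 box at corner `0` with its own chart radius `S0 := 16·S`, co-test `4·toyεθ S0` (rows by `gibbs_sm`∕`gibbs_rad`), its (SM)-row at
the SHARED threshold by file 1's `gibbs_SM_shared` (`θ ≥ 10 616 832·S²`); core radius `S∕3 ≥ θ·η_r²` (leaf-02's `εθ₃_eta_sq_le` at `η = ½`),
`2a ≤ 2 sin(S∕2)`; END-I's rows over `({()}).disjSum {()}` pushed with equality, `D ≡ D̄ := 12 + 4·#(blockBonds × Fin 3)` (the live slot's
literal constant collapses to `4·m₀ = 12`).  ONE displayed number: the live chart radius `0 < S ≤ t²∕10⁹` (inhabited: `t > 0`).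
WHAT THIS DOES NOT DO: the w∕e located-regularity rows are NOT exercised; (T2)∕(T3) are zero kernels; a fixed nonzero read-out does not
visit `η_j → 0` (S105 f2⁗'s in-file (x2⁗) does); two-run closeness is END-I's input by name; the shells' liveness is not re-proved here
(S96 f3 `gibbs_shellPart_pos_A∕_B` and leaf-02's S104 f3 witness are the pointers).  NOTHING in the countdown moves; NE7c NOT PROVED;
spine PROVED 0∕9.
-/

noncomputable section

open Set Metric NormedSpace MeasureTheory Function

namespace Summit.QuantumFields.BalabanUV.T4Continuum.ShellMeasureLiveEndOneCallUnionLevelsCfLinToy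

open scoped ENNReal Matrix.Norms.L2Operator
open Literature.MathematicalPhysics.QuantumFieldTheory.Balaban1983to89
open B11Prop6Scheme (Prop4Hyp)
open B7Prop2Explicit (C0 c2' C0_pos c2'_pos unitaryUnits)
open GaugeField (GaugeInvariant plaqHol)
open T4ShellMeasure (SlotAntiConcentration)
open T4CubePoincare (cube mem_cube_iff)
open T4CubeChartGnomonic (SU2)
open T4CubeChartExp (expPt expFibreChart)
open T4TreeGaugeFixing (NoClosedLoop fixTo)
open T4AxialGaugeFixing (combBonds)
open T4AxialGaugeSmallField (castSite boxPlaqs)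
open T4ExpWindowSmallField (dist1_eq_norm_coe_sub_one)
open T4ShellMeasurePlaquette (expTail₂)
open T4IndicatorShell (ShellWeightBound)
open T4ShellMeasureLevels (LiveWindow)
open ShellMeasureLevelAssembly (classifier)
open ShellMeasureWilsonWords (wordExp wordExp_cons wordExp_nil)
open ShellMeasureMultiGridNorms (WSup)
open ShellMeasurePinnedNorm (pinW)
open ShellMeasureDecayKernelSums (kerOp kerOp_apply)
open ShellMeasureLandauHolonomy (solAt landauExp)
open ShellMeasureLandauHolonomyChart (holOf cplx holOf_apply norm_cplx_le)
open ShellMeasureLandauHolonomySkew (readOutReal)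
open ShellMeasureWilsonRealizedSU2 (M₂ gen coe_chart gen_mem_skewAdjoint wilsonU)
open ShellMeasureWilsonGaugeInvariant (giF giF_le_one)
open ShellMeasureLandauEndFinalToy (toyU toyεθ measurable_toyU gaugeInvariant_toyU smul_mem_cube solAt_zero landauExp_zero toyεθ_pos)
open ShellMeasureLandauEndAssembledToy (norm_kerOp_zero_le kerOp_zero_apply)
open ShellMeasureAverageProp4General (O1cov C2cov C1cov_pos O1cov_pos)
open ShellMeasureLandauCfPinned (C2cov_nonneg)
open ShellMeasureLandauCorrectionB7 (landauRad landauRad_pos)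
open ShellMeasureLandauCorrectionReal (skewPi)
open ShellMeasureLevelZeroBoxWitness (blockBonds boxPlaqF mem_boxPlaqF toyParams toyParams_sitesPerDir blockBonds_box
  disjoint_blockBonds_comb cover_blockBonds boxPlaqF_box dir_zero_lt_one side_two_nonwrapping side_two_side side_two_square)
open ShellMeasureLevelZeroShellMass (shellMass_pos)
open ShellMeasureLiveEndOneCallLevelsToy (gibbs_sm gibbs_rad toyεθ_le_sq sq_le_toyεθ)
open ShellMeasureLiveEndOneCallUnionLevelsToy (lintegral_giF_ne_top twoSlot_liveWindow)
open ShellMeasureLiveEndOneCallUnionLevelsCfLin (shellWeightBound_live_oneCall_union_levels_cfB7_lin)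
open ShellMeasureLandauEndAssembledDecayReachToyData (b₀ p₀ readOut7 norm_readOut7_le readOut7_cplx singleton_box singleton_comb
  plaqHol_p₀_sec)
open ShellMeasureLandauEndAssembledDecayReachToy (toyF7 toyJco7 measurable_toyF7 gaugeInvariant_toyF7 toyF7_le_one toyF7_section_mono
  hcore_toy hcollar_toy)
open ShellMeasureLandauEndBlockSpace (c₀ 𝕐 𝕎 blockW C₄c C₄c_nonneg blockW_prop4Hyp rdL 𝒢L rdL_𝒢L norm_rdL_le norm_𝒢L_le
  real_smul_mem_skewAdjoint)
open ShellMeasureLandauEndAssembledBlockP4 (rdL_solAt_eq_zero)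
open ShellMeasureLandauEndAssembledReachBlockP4 (embOf rdL_embOf_c₀ norm_embOf_le)
open ShellMeasureLandauEndAssembledDecayCfLinWitnessNumbers (tS twS α₀S ampT εθ₃ tS_pos tS_le_one twS_pos ampT_bounds α₀S_pos εθ₃_pos
  row_h3 row_fixedPoint row_h18 row_h3R row_we εθ₃_eta_sq_le)
open ShellMeasureLiveEndOneCallUnionLevelsCfLinToyNumbers (εθ₃_half_lower gibbs_SM_shared two_third_le_two_sin_half lintegral_toyF7_ne_top
  toyF7_measure_ne_top m₀_eq_three_of_singleton norm_H₁η_apply_le norm_TΦη_mul_lt H₁η_TΦη_apply norm_embOf_readOut7_cplx_lt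
  window_numbers threshold_numbers one_mul_amplitude_eq norm_𝒢Lη_le alpha_rows tuple_rows stokes_rows)

variable [DecidableEq (PBond toyParams 0)]

/-! ## §2 THE ONE CALL OF RECORD v3 APPLIED BY NAME TO THE TWO-LEG, TWO-SCALE SCHEME WITH (P4) ∧ (T1) LIVE -/

/-- **RULE G-1 FOR THE ONE CALL OF RECORD v3 WITH (P4) ∧ (T1) LIVE**: S105 f3⁗ `shellWeightBound_live_oneCall_union_levels_cfB7_lin`
APPLIED BY NAME to the two-leg two-scale scheme of the module docstring — every binder family supplied; the background-mediated slots
carry leaf-02's block field space ((P4) inhabited by `blockW_prop4Hyp`, propagator letter `𝒢L ≠ 0`) and the LINEAR chart map `TΦ`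
with R10's number relation `hTb` met; ONE displayed number: the live chart radius `0 < S ≤ t²∕10⁹`.  A consistency certificate;
nothing about Bałaban's objects; NE7c NOT PROVED. [folklore] -/
theorem shellWeightBound_live_oneCall_union_levels_cfB7_lin_toy
    (hPu : (boxPlaqF (P := toyParams) (j := 0) 0 (fun _ => (0 : ℤ) + 2)).Nonempty)
    {i₀ i₁ : Fin toyParams.d} (h01 : i₀ < i₁) {m₀ : Bool → ℕ → ℕ}
    (e : ∀ r K, ↥({b₀ (0 : Fin toyParams.d → ℤ) i₀ i₁} : Finset (PBond toyParams 0)) × Fin 3 ≃ Fin (m₀ r K))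
    {S : ℝ} (hS : 0 < S) (hSb : S ≤ tS toyParams.d toyParams.L ^ 2 / 10 ^ 9)
    {θ : ℝ} (hθ : θ = εθ₃ 2 toyParams.d toyParams.L S (1 / 2))
    {ϑ : ℝ} (hϑ0 : 0 < ϑ) (hϑ1 : ϑ < 1) (l₀ : ℝ) :
    ShellWeightBound l₀ (fun _ : ℕ => ({()} : Finset Unit))
      (fun _ _ _ => (((fieldMeasure toyParams 0 SU2).withDensity
          (giF (0 : Fin toyParams.d → ℤ) (fun _ => (0 : ℤ) + 2) (4 * toyεθ (16 * S)) 0 ∅)) Set.univ).toReal +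
        (((fieldMeasure toyParams 0 SU2).withDensity (toyF7 (0 : Fin toyParams.d → ℤ) h01 (S / 3))) Set.univ).toReal)
      (fun _ _ _ => (((fieldMeasure toyParams 0 SU2).withDensity
          (giF (0 : Fin toyParams.d → ℤ) (fun _ => (0 : ℤ) + 2) (4 * toyεθ (16 * S)) 0 ∅)) Set.univ).toReal +
        (((fieldMeasure toyParams 0 SU2).withDensity (toyF7 (0 : Fin toyParams.d → ℤ) h01 (S / 3))) Set.univ).toReal)
      (fun K _ _ => (((fieldMeasure toyParams 0 SU2).withDensity
          (giF (0 : Fin toyParams.d → ℤ) (fun _ => (0 : ℤ) + 2) (4 * toyεθ (16 * S)) 0 ∅))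
          {U | θ * (1 - ϑ ^ K / 4) ≤ wilsonU hPu U / 1 ^ 2 ∧ wilsonU hPu U / 1 ^ 2 < θ}).toReal +
        (((fieldMeasure toyParams 0 SU2).withDensity (toyF7 (0 : Fin toyParams.d → ℤ) h01 (S / 3)))
          {U | θ * (1 - ϑ ^ K / 4) ≤ toyU (p₀ (0 : Fin toyParams.d → ℤ) i₀ i₁ h01) U / 1 ^ 2 ∧
            toyU (p₀ (0 : Fin toyParams.d → ℤ) i₀ i₁ h01) U / 1 ^ 2 < θ}).toReal)
      (fun K _ _ => (((fieldMeasure toyParams 0 SU2).withDensity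
          (giF (0 : Fin toyParams.d → ℤ) (fun _ => (0 : ℤ) + 2) (4 * toyεθ (16 * S)) 0 ∅))
          {U | θ * (1 - ϑ ^ K / 4) ≤ wilsonU hPu U / (1 / 2) ^ 2 ∧ wilsonU hPu U / (1 / 2) ^ 2 < θ}).toReal +
        (((fieldMeasure toyParams 0 SU2).withDensity (toyF7 (0 : Fin toyParams.d → ℤ) h01 (S / 3)))
          {U | θ * (1 - ϑ ^ K / 4) ≤ toyU (p₀ (0 : Fin toyParams.d → ℤ) i₀ i₁ h01) U / (1 / 2) ^ 2 ∧
            toyU (p₀ (0 : Fin toyParams.d → ℤ) i₀ i₁ h01) U / (1 / 2) ^ 2 < θ}).toReal)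
      (fun K => ∑ _s ∈ (({()} : Finset Unit).disjSum ({()} : Finset Unit)),
          (12 + 4 * ((Fintype.card (↥(blockBonds (P := toyParams) (j := 0) 0 (fun _ => (0 : ℤ) + 2)) × Fin 3) : ℕ) : ℝ)) *
            (ϑ ^ K / 4) +
        ∑ _s ∈ (({()} : Finset Unit).disjSum ({()} : Finset Unit)),
          (12 + 4 * ((Fintype.card (↥(blockBonds (P := toyParams) (j := 0) 0 (fun _ => (0 : ℤ) + 2)) × Fin 3) : ℕ) : ℝ)) *
            (ϑ ^ K / 4)) := by
  -- ══ numbers (file 1, packaged): the live radius window, the shared threshold, the Gibbs radius `S0 = 16 S`, leaf-02's scales ══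
  have hL1 : 1 ≤ toyParams.L := toyParams.hL.2.le
  have ht0 : 0 < tS toyParams.d toyParams.L := tS_pos hL1
  have ht1 : tS toyParams.d toyParams.L ≤ 1 := tS_le_one
  obtain ⟨hS9, hSr, hSrη, -, hSπ, hS0π⟩ := window_numbers hL1 hS hSb
  obtain ⟨hθ0, hθη, hSMr⟩ := threshold_numbers hL1 hS hSb hθ
  have hS1 : S ≤ 1 := by linarith
  have hS0 : 0 < 16 * S := by positivity
  have hS06 : 16 * S ≤ 1 / 10 ^ 6 := by linarith
  have hS08 : 16 * S ≤ 1 / 8 := by linarith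
  have hgε0 : 0 < toyεθ (16 * S) := toyεθ_pos hS0 (by linarith)
  have hρ1 : ∀ K : ℕ, ϑ ^ K / 4 ≤ (1 - 1 / 2) / 2 := fun K => by
    have := pow_le_one₀ hϑ0.le hϑ1.le (n := K); linarith
  have h3 : 3 ≤ toyParams.sitesPerDir 0 := by rw [toyParams_sitesPerDir]; norm_num
  have hN := side_two_nonwrapping (j := 0) h3 (0 : Fin toyParams.d → ℤ)
  set CARD : ℕ := Fintype.card (↥(blockBonds (P := toyParams) (j := 0) 0 (fun _ => (0 : ℤ) + 2)) × Fin 3) with hCARDdef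
  have hCARD : (0 : ℝ) ≤ (CARD : ℝ) := Nat.cast_nonneg _
  have hm3 : ∀ r K, m₀ r K = 3 := fun r K => m₀_eq_three_of_singleton _ (e r K)
  have hsm := gibbs_sm hS0 hS08
  have hSMσ : 4 * (8 * (16 * S)) ^ 2 * Real.exp (2 * (8 * (16 * S))) ≤ 1 / 2 * (4 * toyεθ (16 * S)) := by nlinarith
  have hD₀' : 2 * ((CARD : ℝ) + 0 * ∑ _p ∈ (∅ : Finset (Plaq toyParams 0)), (8 * (16 * S)) * (8 + 4 * (8 * (16 * S)))) /
      (1 - 1 / 2) ≤ 12 + 4 * (CARD : ℝ) := by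
    rw [Finset.sum_empty, mul_zero, add_zero]; linarith [show 2 * (CARD : ℝ) / (1 - 1 / 2) = 4 * CARD by ring]
  -- leaf-02's (T1) block-space numbers, per run through `η_r = cond r 1 ½`
  have hC := C₄c_nonneg 2 (by norm_num)
  have hC1 : 0 < C₄c 2 + 1 := by linarith
  have hB₀ : 0 < 1 / (C₄c 2 + 1) := by positivity
  have hB₀1 : 1 / (C₄c 2 + 1) ≤ 1 := by rw [div_le_one hC1]; linarith
  have hd01 : (0 : Fin 2) ≠ 1 := by decide
  have hη0 : ∀ r : Bool, 0 < cond r (1 : ℝ) (1 / 2) := fun r => by cases r <;> norm_num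
  have hη1 : ∀ r : Bool, cond r (1 : ℝ) (1 / 2) ≤ 1 := fun r => by cases r <;> norm_num
  have h𝒢B : ∀ r : Bool, ∀ f : 𝕎 2, ‖𝒢L 2 (cond r (1 : ℝ) (1 / 2)) (1 / (C₄c 2 + 1) * cond r (1 : ℝ) (1 / 2) / 2) f‖ ≤
      1 / (C₄c 2 + 1) * ‖f‖ := fun r f => norm_𝒢Lη_le (hη0 r) (hη1 r) f
  have hR7 : ∀ r K, ∀ y : Fin (m₀ r K) → ℂ, ‖readOut7 0 (e r K) y‖ ≤ 3 * ‖y‖ := fun r K y => norm_readOut7_le 0 (e r K) y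
  obtain ⟨hdom', hself', hcontr'⟩ := row_fixedPoint hC ht0.le ht1
  obtain ⟨h1', h2', hcoup'⟩ := tuple_rows (t := tS toyParams.d toyParams.L) hC ht1
  obtain ⟨hα3', hα4', hα6'⟩ := alpha_rows toyParams.d toyParams.L
  have hrows := fun r : Bool => stokes_rows toyParams.d toyParams.L hL1 S r
  have hα := α₀S_pos (d' := toyParams.d) hL1
  have htw0 : 0 < twS toyParams.d toyParams.L := twS_pos hL1
  obtain ⟨hdomw', hqw', hRCw', hqe', hRCe', hcoupE'⟩ := row_we (d' := toyParams.d) hL1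
  -- the carrier families' instances, found once per run (the block space `𝕐 2 η_r` is a `WMax` abbreviation)
  letI instY₁ : ∀ r : Bool, NormedAddCommGroup (𝕐 2 (cond r (1 : ℝ) (1 / 2))) := fun r => inferInstance
  letI instY₂ : ∀ r : Bool, NormedSpace ℂ (𝕐 2 (cond r (1 : ℝ) (1 / 2))) := fun r => inferInstance
  letI instY₃ : ∀ r : Bool, CompleteSpace (𝕐 2 (cond r (1 : ℝ) (1 / 2))) := fun r => inferInstance
  -- ══ the families (as S96 f3): density∕variable `Sum.elim`, the two realized laws, the shells, the pieces ══
  set Fam : Bool → ℕ → Unit ⊕ Unit → (GaugeField toyParams 0 SU2 → ℝ≥0∞) := fun _ _ s =>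
    Sum.elim (fun _ => giF (0 : Fin toyParams.d → ℤ) (fun _ => (0 : ℤ) + 2) (4 * toyεθ (16 * S)) 0 ∅)
      (fun _ => toyF7 (0 : Fin toyParams.d → ℤ) h01 (S / 3)) s with hFam
  set ufam : Bool → ℕ → Unit ⊕ Unit → (GaugeField toyParams 0 SU2 → ℝ) := fun _ _ s =>
    Sum.elim (fun _ => wilsonU hPu) (fun _ => toyU (p₀ (0 : Fin toyParams.d → ℤ) i₀ i₁ h01)) s with hufam
  set μg : Measure (GaugeField toyParams 0 SU2) := (fieldMeasure toyParams 0 SU2).withDensity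
    (giF (0 : Fin toyParams.d → ℤ) (fun _ => (0 : ℤ) + 2) (4 * toyεθ (16 * S)) 0 ∅) with hμg
  set μ7 : Measure (GaugeField toyParams 0 SU2) := (fieldMeasure toyParams 0 SU2).withDensity
    (toyF7 (0 : Fin toyParams.d → ℤ) h01 (S / 3)) with hμ7
  set Shg : Bool → ℕ → Set (GaugeField toyParams 0 SU2) := fun r K =>
    {U | θ * (1 - ϑ ^ K / 4) ≤ wilsonU hPu U / cond r 1 (1 / 2) ^ 2 ∧ wilsonU hPu U / cond r 1 (1 / 2) ^ 2 < θ}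
  set Sh7 : Bool → ℕ → Set (GaugeField toyParams 0 SU2) := fun r K =>
    {U | θ * (1 - ϑ ^ K / 4) ≤ toyU (p₀ (0 : Fin toyParams.d → ℤ) i₀ i₁ h01) U / cond r 1 (1 / 2) ^ 2 ∧
      toyU (p₀ (0 : Fin toyParams.d → ℤ) i₀ i₁ h01) U / cond r 1 (1 / 2) ^ 2 < θ}
  set piece : Bool → ℕ → Unit ⊕ Unit → ℝ := fun r K s => Sum.elim (fun _ => (μg (Shg r K)).toReal) (fun _ => (μ7 (Sh7 r K)).toReal) s
  have hμg_fin : ∀ B, μg B ≠ ∞ := fun B => ne_top_of_le_ne_top (ne_top_of_le_ne_top ENNReal.one_ne_top (by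
    rw [hμg, withDensity_apply _ MeasurableSet.univ, Measure.restrict_univ]
    exact (lintegral_mono fun U => giF_le_one _ _ le_rfl ∅ U).trans_eq (by rw [lintegral_one, measure_univ])))
    (measure_mono (subset_univ B))
  have hμ7_fin : ∀ B, μ7 B ≠ ∞ := fun B => toyF7_measure_ne_top _ h01 _ B
  -- END-I's rows, per run
  have sh_nonneg : ∀ (r : Bool) (K : ℕ) (t : ℝ), |t| ≤ l₀ → ∀ τ ∈ ({()} : Finset Unit),
      0 ≤ (μg (Shg r K)).toReal + (μ7 (Sh7 r K)).toReal := fun _ _ _ _ _ _ => by positivity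
  have sh_le : ∀ (r : Bool) (K : ℕ) (t : ℝ), |t| ≤ l₀ → ∀ τ ∈ ({()} : Finset Unit),
      (μg (Shg r K)).toReal + (μ7 (Sh7 r K)).toReal ≤ (μg Set.univ).toReal + (μ7 Set.univ).toReal :=
    fun r K _ _ _ _ => add_le_add (ENNReal.toReal_mono (hμg_fin _) (measure_mono (subset_univ _)))
      (ENNReal.toReal_mono (hμ7_fin _) (measure_mono (subset_univ _)))
  have cover : ∀ (r : Bool) (K : ℕ) (t : ℝ), |t| ≤ l₀ → ∀ τ ∈ ({()} : Finset Unit),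
      (μg (Shg r K)).toReal + (μ7 (Sh7 r K)).toReal ≤ ∑ s ∈ (({()} : Finset Unit).disjSum ({()} : Finset Unit)), piece r K s :=
    fun _ _ _ _ _ _ => by rw [Finset.sum_disjSum, Finset.sum_singleton, Finset.sum_singleton]; exact le_rfl
  have hM : ∀ (r : Bool) (K : ℕ) (t : ℝ), |t| ≤ l₀ → ∀ s ∈ (({()} : Finset Unit).disjSum ({()} : Finset Unit)), (0 : ℝ) ≤ 1 :=
    fun _ _ _ _ _ _ => zero_le_one
  have piece_le : ∀ (r : Bool) (K : ℕ) (t : ℝ), |t| ≤ l₀ → ∀ s ∈ (({()} : Finset Unit).disjSum ({()} : Finset Unit)),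
      ∑ _τ ∈ ({()} : Finset Unit), piece r K s ≤ 1 * (((fieldMeasure toyParams 0 SU2).withDensity (Fam r K s))
        {U | θ * (1 - ϑ ^ K / 4) ≤ ufam r K s U / cond r 1 (1 / 2) ^ 2 ∧
          ufam r K s U / cond r 1 (1 / 2) ^ 2 < θ}).toReal := by
    intro r K t _ s hs
    rcases Finset.mem_disjSum.1 hs with ⟨a, -, rfl⟩ | ⟨b, -, rfl⟩ <;> (rw [Finset.sum_singleton, one_mul]; exact le_rfl)
  have total_ge : ∀ (r : Bool) (K : ℕ) (t : ℝ), |t| ≤ l₀ → ∀ s ∈ (({()} : Finset Unit).disjSum ({()} : Finset Unit)),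
      1 * (((fieldMeasure toyParams 0 SU2).withDensity (Fam r K s)) Set.univ).toReal ≤
        ∑ _τ ∈ ({()} : Finset Unit), ((μg Set.univ).toReal + (μ7 Set.univ).toReal) := by
    intro r K t _ s hs
    rcases Finset.mem_disjSum.1 hs with ⟨a, -, rfl⟩ | ⟨b, -, rfl⟩ <;> rw [Finset.sum_singleton, one_mul]
    · exact le_add_of_nonneg_right ENNReal.toReal_nonneg
    · exact le_add_of_nonneg_left ENNReal.toReal_nonneg
  refine shellWeightBound_live_oneCall_union_levels_cfB7_lin (σ₀ := Unit) (σ₁ := Unit) (n := Fin 2) (fun _ _ _ => toyParams) (fun _ _ _ => 0) (fun _ K _ => K)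
    (ε := fun _ _ => θ) (η := fun r _ => cond r 1 (1 / 2)) (ρ := fun _ j' => ϑ ^ j' / 4) (β := fun _ _ => 0)
    (D := fun _ _ => 12 + 4 * (CARD : ℝ)) (fun r _ => hη0 r) (fun _ _ => hθ0) (fun _ _ => by positivity) (fun _ _ => by positivity)
    (fun _ _ => ({()} : Finset Unit)) (fun _ _ => ({()} : Finset Unit)) (l₀ := l₀) (fun r K _ s => Fam r K s) (fun r K _ s => ufam r K s)
    -- ══ (T1) ON THE BLOCK FIELD SPACE (leaf-02's R10∕S77 f8): carrier families per run ══
    (𝒴 := fun r _ _ => 𝕐 2 (cond r (1 : ℝ) (1 / 2))) (𝒵 := fun _ _ _ => 𝕎 2) (ℬ := fun r K _ => Fin (m₀ r K) → ℂ) (𝔸 := fun _ _ _ => ℂ)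
    -- the host box: corner `0`, side `2`, the one-bond block `{b₀ 0 i₀ i₁}` off the comb
    (lo := fun _ _ _ => (0 : Fin toyParams.d → ℤ)) (hi := fun _ _ _ => fun κ => (0 : Fin toyParams.d → ℤ) κ + 2)
    (nb := fun _ _ _ => 2) (fun _ _ _ => side_two_side (P := toyParams) 0) (fun _ _ _ => hN)
    (fun _ _ _ => {b₀ (0 : Fin toyParams.d → ℤ) i₀ i₁}) (fun _ _ _ => singleton_box hN h01) (fun _ _ _ => singleton_comb hN h01)
    (m₀ := fun r K _ => m₀ r K) (fun r K _ => e r K) hS hSπ (fun _ _ _ _ => measurable_toyF7 0 h01 (S / 3)) (fun _ _ _ _ => gaugeInvariant_toyF7 0 h01 (S / 3))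
    (fun _ _ _ _ => measurable_toyU (p₀ 0 i₀ i₁ h01)) (fun _ _ _ _ => gaugeInvariant_toyU (p₀ 0 i₀ i₁ h01))
    (ιc := fun _ _ _ => Unit) (Pu := fun _ _ _ _ => {()}) (fun _ _ _ _ => Finset.singleton_nonempty ())
    (fun r K _ _ _ => cube (m₀ r K) S) (fun r K _ _ => toyJco7 0 h01 (e r K) S (S / 3)) (δ := 1 / 2)
    (fun r _ _ _ _ => 𝒢L 2 (cond r (1 : ℝ) (1 / 2)) (1 / (C₄c 2 + 1) * cond r (1 : ℝ) (1 / 2) / 2)) (fun r _ _ _ _ => blockW 2 (cond r (1 : ℝ) (1 / 2)))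
    (B₀ := 1 / (C₄c 2 + 1)) (C₄ := C₄c 2) (a₃ := 1 / 8) (ε₄ := tS toyParams.d toyParams.L / 32)
    (fun r _ _ _ _ f => h𝒢B r f) (fun r _ _ _ _ => blockW_prop4Hyp 2 (by norm_num) (hη0 r) (hη1 r)) hB₀ hC (by positivity)
    (dL := 1) (C₁ := 1) (B₃ := 1) (ε₁ := tS toyParams.d toyParams.L * (C₄c 2 + 1) / 64)
    zero_le_one zero_le_one (by positivity) le_rfl h1' h2' (row_h3 hC ht0.le ht1)
    (fun r K _ _ _ => (((1 / (C₄c 2 + 1)) / (6 / cond r (1 : ℝ) (1 / 2)) : ℝ) : ℂ) • embOf 2 (cond r (1 : ℝ) (1 / 2)) (c₀ 2)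
      (readOut7 0 (e r K))) (fun r K _ _ V B => norm_H₁η_apply_le _ (hR7 r K) (hη0 r) (hη1 r) hC1 B)
    -- ══ R10: THE LINEAR COARSE-DATUM MAP `TΦ := (6∕(η_r B₀))•id`, ONE polydisc radius `rΦ := t∕768`, `hTb` MET ══
    (fun r K _ _ _ => (((6 / cond r (1 : ℝ) (1 / 2)) / (1 / (C₄c 2 + 1)) : ℝ) : ℂ) • ContinuousLinearMap.id ℂ (Fin (m₀ r K) → ℂ))
    (rΦ := tS toyParams.d toyParams.L / 768) (fun r K _ _ V => norm_TΦη_mul_lt (hη0 r) (by cases r <;> norm_num) ht0 hC) hSr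
    -- ══ R11′: slot level `0`, EMPTY stencils, background `1`, α₀-rows GENUINE, located regularity VACUOUS, e-pins ══
    (fun _ _ _ => 0) (fun _ _ _ => ∅) (fun _ _ _ => ∅) (fun _ _ _ => ∅) (fun _ _ _ => ∅) (fun _ _ _ => ∅) (fun _ _ _ => ∅)
    (fun _ _ _ _ _ _ _ => 1) (fun _ _ _ _ _ _ _ => (unitaryUnits ℂ).one_mem) (α₀ := α₀S toyParams.d toyParams.L) hα
    (fun _ _ _ => hα3') (fun _ _ _ => hα4') (fun _ _ _ => hα6')
    (fun _ _ _ _ _ c => absurd c.2 (Finset.notMem_empty _)) (fun _ _ _ _ _ c => absurd c.2 (Finset.notMem_empty _))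
    (fun _ _ _ _ _ => 0) (fun _ _ _ _ _ => 0) (fun _ _ _ _ _ => le_rfl) (fun _ _ _ _ _ => le_rfl) (r₀e := 0)
    (fun _ _ _ _ c => absurd c.2 (Finset.notMem_empty _))
    -- the u-tuple's Landau maps (degenerate on the empty stencil) and the number rows `h18 hcoup h3R`
    (fun _ _ _ _ _ => 0) (fun _ _ _ _ _ Y => by rw [zero_apply, norm_zero]; exact norm_nonneg _) (fun _ _ _ _ _ => 0)
    (fun _ _ _ _ _ X => by rw [zero_apply, norm_zero]; exact mul_nonneg hB₀.le (norm_nonneg X))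
    (ε₃ := tS toyParams.d toyParams.L / 16) (fun _ _ _ => row_h18 hL1 hB₀1) hcoup' (fun _ _ _ => row_h3R)
    (fun r _ _ _ _ => [rdL 2 (cond r (1 : ℝ) (1 / 2))]) (κr := fun _ _ => 1) (fun _ _ _ => zero_le_one)
    (fun r _ _ _ _ _ ℓ hℓ Y => by rw [List.mem_singleton.1 hℓ, one_mul]; exact norm_rdL_le 2 _ Y) (m := 1)
    (fun _ _ _ _ _ _ => by simp) (κc := fun _ _ => 1) (fun _ _ _ => zero_le_one) (fun r _ _ _ _ _ Y => by simpa using norm_rdL_le 2 (cond r (1 : ℝ) (1 / 2)) Y)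
    -- ══ (T2): degenerate-but-legal data, letters `twS` (leaf-02's rows against `C2cov`∕`landauRad`) ══
    (Λw := fun _ _ _ => Unit) (Λz := fun _ _ _ => Unit) (Λb := fun _ _ _ => Unit) (𝔖 := fun _ _ _ => Unit)
    (𝔄w := fun _ _ _ => ℂ) (ℭ := fun _ _ _ => ℂ) (𝔇 := fun _ _ _ => ℂ) (δw := 0) le_rfl (fun _ _ _ _ _ => 0) (fun _ _ _ _ _ _ => 0) (fun _ _ _ _ _ _ => by simp)
    (fun _ _ _ _ => id) (fun _ _ _ _ => id) (fun _ _ _ _ _ => ()) (fun _ _ _ _ _ => ()) (fun _ _ _ _ => id)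
    (fun _ _ _ _ _ _ _ => 0) (fun _ _ _ _ _ _ _ => 0) (fun _ _ _ _ _ _ _ => 0) (fun _ _ _ _ _ _ _ => 0)
    (c𝒢 := 0) (δ𝒢 := 0) (M𝒢 := 1) (cι := 0) (δι := 0) (Mι := 1) (cH := 0) (δH := 0) (MH := 1) (cH₁ := 0) (δH₁ := 0) (MH₁ := 1)
    le_rfl zero_le_one (fun _ _ _ _ _ _ _ => by simp) (fun _ _ _ _ _ => by simp) le_rfl zero_le_one (fun _ _ _ _ _ _ _ => by simp) (fun _ _ _ _ _ => by simp)
    le_rfl zero_le_one (fun _ _ _ _ _ _ _ => by simp) (fun _ _ _ _ _ => by simp) le_rfl zero_le_one (fun _ _ _ _ _ _ _ => by simp) (fun _ _ _ _ _ => by simp)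
    (fun _ _ _ _ _ _ => 0) (B₀w := 1) (C₄w := 0) (a₃w := 2 / 3) (ε₄w := twS toyParams.d toyParams.L) (bw := twS toyParams.d toyParams.L)
    (fun _ _ _ _ _ f => norm_kerOp_zero_le zero_le_one f) (fun _ _ _ _ _ => ⟨fun Y _ => by simp, differentiableOn_const _⟩)
    one_pos le_rfl htw0.le hdomw' (by rw [mul_zero, zero_mul]; exact htw0.le) (by norm_num) (fun _ _ _ _ _ B => norm_kerOp_zero_le zero_le_one B)
    (fun _ _ _ _ _ => 0) (rΦw := 1) (fun _ _ _ _ _ => by rw [norm_zero, zero_mul]; exact htw0) (by linarith)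
    (fun _ _ _ _ _ Y => by simpa using norm_kerOp_zero_le zero_le_one Y) (fun _ _ _ _ _ X => norm_kerOp_zero_le zero_le_one X)
    (fun _ _ _ => hqw') (fun _ _ _ => hRCw') (fun _ _ _ _ _ _ => True) (fun _ _ _ _ _ A A' c' _ => rfl) (rW := 0) (fun _ _ _ _ _ _ _ => by simp)
    (rC := 0) (fun _ _ _ _ c' => absurd c'.2 (Finset.notMem_empty _)) (fun _ _ _ _ _ z i _ => rfl) (by norm_num) (fun _ _ _ => by simp)
    (𝔭 := fun _ _ _ => Unit) (fun _ _ _ _ => {()}) (fun _ _ _ _ _ => [0]) (fun _ _ _ _ _ => ∅) (fun _ _ _ _ _ => 0)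
    (fun _ _ _ _ _ _ ℓ hℓ A A' _ => by rw [List.mem_singleton.1 hℓ]; simp) (fun _ _ _ _ _ _ b' hb' => absurd hb' (Finset.notMem_empty _))
    (fun _ _ _ _ _ _ => le_rfl) (κwb := fun _ _ => 1) (κcb := fun _ _ => 1) (fun _ _ _ => zero_le_one) (fun _ _ _ => zero_le_one) (fun _ _ _ _ _ _ ℓ hℓ => by
      rw [List.mem_singleton.1 hℓ]; exact ContinuousLinearMap.opNorm_le_bound _ zero_le_one fun Y => by simp) (fun _ _ _ _ _ _ => by
      rw [List.sum_cons, List.sum_nil, add_zero]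
      exact ContinuousLinearMap.opNorm_le_bound _ zero_le_one fun Y => by simp) (mw := 1) (fun _ _ _ _ _ _ => by simp)
    (fun _ _ _ _ => ⊤) (fun _ _ _ _ => by simp) (fun _ _ _ _ => ⊤) (fun _ _ _ _ => ⊤)
    (fun _ _ _ _ _ f _ => AddSubgroup.mem_top _) (fun _ _ _ _ _ Y _ => AddSubgroup.mem_top _)
    (fun _ _ _ _ _ Y _ => by rw [kerOp_zero_apply]; exact AddSubgroup.zero_mem _) (fun _ _ _ _ _ X _ => AddSubgroup.mem_top _)
    (fun _ _ _ _ _ B _ => AddSubgroup.mem_top _) (fun _ _ _ _ _ y => AddSubgroup.mem_top _) (fun _ _ _ _ _ _ ℓ hℓ Y _ => by rw [List.mem_singleton.1 hℓ]; simp)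
    (fun _ _ _ _ _ _ => 1) (d := fun _ _ _ _ _ => 0) (dbar := fun _ _ => 0) (fun _ _ _ _ _ _ _ => (unitary _).one_mem)
    (fun _ _ _ _ _ _ _ => by simp) (fun _ _ _ _ _ _ => le_rfl) (fun _ _ _ => le_rfl) (Kw := fun _ _ => 1) (fun _ _ _ _ => by simp)
    -- ══ (T3): degenerate data, letters `twS` ══
    (Λe := fun _ _ _ => Unit) (𝔄 := fun _ _ _ => ℂ) (δ' := 0) (ϖ := fun _ _ _ _ _ => 0) le_rfl (fun _ _ _ _ _ => le_rfl)
    (𝒵e := fun _ _ _ => ℂ) (ℬe := fun _ _ _ => ℂ)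
    (fun _ _ _ _ _ => 0) (fun _ _ _ _ _ _ => 0) (B₀e := 1) (C₄e := 0) (a₃e := 2 / 3) (be := twS toyParams.d toyParams.L) (ε₄e := twS toyParams.d toyParams.L)
    (fun _ _ _ _ _ f => by simp) (fun _ _ _ _ _ => ⟨fun Y _ => by simp, differentiableOn_const _⟩) one_pos le_rfl htw0.le htw0.le
    hdomw' (by rw [mul_zero, zero_mul]; exact htw0.le) (by norm_num) (fun _ _ _ _ _ => 0) (fun _ _ _ _ _ B => by simp) (fun _ _ _ _ _ => 0) (rΦe := 1)
    (fun _ _ _ _ _ => by rw [norm_zero, zero_mul]; exact htw0) (by linarith)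
    (fun _ _ _ _ _ => 0) (fun _ _ _ _ _ Y => by simp) (fun _ _ _ _ _ => 0) (fun _ _ _ _ _ X => by simp) (fun _ _ _ => hqe') (fun _ _ _ => hRCe')
    (𝔱 := fun _ _ _ => Unit) (fun _ _ _ _ => {()}) (Ef := fun _ _ _ _ _ _ => 0) (rE := 1) (ee := fun _ _ _ _ _ => 0) one_pos
    (fun _ _ _ _ _ _ => differentiableOn_const _) (fun _ _ _ _ _ _ Z _ => by simp) (fun _ _ _ _ _ _ => le_rfl)
    (fun _ _ _ _ _ => ∅) (fun _ _ _ _ _ _ A₁ A₂ _ => rfl) (fun _ _ _ _ _ => 0) (fun _ _ _ _ _ _ b' hb' => absurd hb' (Finset.notMem_empty _))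
    (LK := 0) le_rfl (fun _ _ _ _ => by simp) (fun _ _ _ => hcoupE') (BE₁ := 0) (fun _ _ _ _ _ y _ => by simp)
    -- ══ (S78): the one-point probability space, `g = 1`, `A = 0`, `B_d = 0` ══
    (Ω := fun _ _ _ => Unit) (fun _ _ _ _ => Measure.dirac ()) (g := fun _ _ _ _ _ => 1) (fun _ _ _ _ _ => zero_le_one)
    (fun _ _ _ _ _ _ _ => 0) (Bd := 0) le_rfl
    (fun _ _ _ _ _ x _ c' _ _ => by simp) (fun _ _ _ _ _ x _ c' _ _ => by simp) (fun _ _ _ _ _ x _ c' _ _ ω => by simp) (BE₂ := 0)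
    (fun _ _ _ _ _ y _ => by simp)
    -- ══ (T1)'s real structure and dictionary READ THROUGH THE BLOCK SPACE (leaf-02's S104 f3 bullets, per run), co-tests, numbers ══
    (fun r _ _ _ => {rdL 2 (cond r (1 : ℝ) (1 / 2))}) (fun _ _ _ _ => ⊤) (fun r K _ _ => readOutReal {readOut7 0 (e r K)})
    (fun r _ _ _ _ f _ => ?_) (fun _ _ _ _ _ Y _ => AddSubgroup.mem_top _)
    (fun _ _ _ _ _ Y _ => by rw [zero_apply]; exact AddSubgroup.zero_mem _) (fun _ _ _ _ _ X _ => by simp)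
    (fun r K _ _ _ B hB => ?_) (fun r K _ _ _ y => ?_) (fun r K _ _ V x hx => ?_) (fun r K _ _ V x hxu => ?_)
    (fun r K _ _ V x hJ => ?_) (fun r K _ _ V x t' ht' => ?_) (fun r K _ _ V x => ?_)
    (fun _ _ _ _ _ => ShellMeasureLandauHolonomyPrint.chartCube_subset_closedBall hS.le)
    (by norm_num) (by norm_num) (c₁ := 4 * ampT 2 toyParams.d toyParams.L) (c₂ := 2 * ampT 2 toyParams.d toyParams.L) (zs := 1)
    (fun r _ _ => (hrows r).1) (fun r _ _ => (hrows r).2.1) (fun r _ _ => (hrows r).2.2.1)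
    (fun r _ _ => by rw [hθ]; exact (hrows r).2.2.2)
    -- ══ the γ3 pair of the host: core radius `a := S∕3` (threshold below it, `2a ≤ 2 sin(S∕2)`), core = `{p₀}`, collar = the box ══
    (a := S / 3) (by positivity)
    (fun _ _ _ => by have h := two_third_le_two_sin_half hS hS1; norm_num [toyParams]; linarith) (Pcore := fun _ _ _ _ => ({p₀ (0 : Fin toyParams.d → ℤ) i₀ i₁ h01} : Set (Plaq toyParams 0)))
    (Pcollar := fun _ _ _ _ => boxPlaqs (0 : Fin toyParams.d → ℤ) (fun κ => (0 : Fin toyParams.d → ℤ) κ + 2))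
    (fun _ _ _ _ q hq => Or.inr hq) (fun r _ _ _ => hcore_toy 0 h01 (hθη r)) (fun _ _ _ _ => hcollar_toy 0 h01 hN (by positivity))
    (fun _ j' => hρ1 j') (fun _ _ => le_rfl)
    -- the slot → level majorant: the host's literal constant collapses to `4·m₀ = 12`
    (fun r K _ _ _ _ => by rw [hm3 r K]; norm_num [hCARD])
    -- ══ the GIBBS LEG (`Sum.inl`): S89 f1's side-2 block of `toyParams` at level 0, chart radius `S0 = 16 S`, co-test `4·toyεθ S0` ══
    (fun _ _ _ => (0 : Fin toyParams.d → ℤ)) (fun _ _ _ => fun _ => (0 : ℤ) + 2) (mb := fun _ _ _ => 2)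
    (fun _ _ _ => hN) (fun _ _ _ => side_two_side (P := toyParams) 0)
    (fun _ _ _ => blockBonds 0 _) (fun _ _ _ => blockBonds_box 0 _) (fun _ _ _ => disjoint_blockBonds_comb 0 _)
    (fun _ _ _ => cover_blockBonds 0 _) (fun _ _ _ => Fintype.equivFin _)
    (S0 := 16 * S) hS0 hS08 hS0π (σc := fun _ _ _ => 4 * toyεθ (16 * S)) (fun _ _ _ => mul_pos four_pos hgε0) (fun _ _ _ => gibbs_rad hS0 hS06)
    (fun _ _ _ => hPu) (fun _ _ _ => boxPlaqF_box 0 _) (fun _ _ _ => ∅)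
    (fun r _ _ => hSMr r) (fun _ _ _ => hSMσ) (fun _ _ _ => hD₀') (fun _ _ _ _ _ => rfl) (fun _ _ _ _ _ => rfl)
    -- ══ END-I's own rows over `({()}).disjSum {()}`: one term per `K`, weights = the two legs' total masses, pieces pushed with equality ══
    (ι := Unit) (T := fun _ => ({()} : Finset Unit)) (pieceA := fun K _ s _ => piece true K s) (pieceB := fun K _ s _ => piece false K s)
    (MA := fun _ _ _ => 1) (MB := fun _ _ _ => 1) (N₁ := 0) (νbar := 2) (Dbar := 12 + 4 * (CARD : ℝ)) (crate := 1 / 4) (ϑ := ϑ)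
    (fun _ _ _ s => by cases s; exacts [lintegral_giF_ne_top (16 * S), lintegral_toyF7_ne_top _ h01 _])
    (sh_nonneg true) (sh_le true) (cover true) (hM true) (piece_le true) (total_ge true)
    (sh_nonneg false) (sh_le false) (cover false) (hM false) (piece_le false) (total_ge false)
    (fun _ => twoSlot_liveWindow) hϑ0 hϑ1 (fun _ _ => le_rfl) (fun _ j' => le_of_eq (by ring))
  · -- `h𝒢r`: the read-out never sees the propagator letter
    intro ℓ hℓ
    rw [Set.mem_singleton_iff.1 hℓ, rdL_𝒢L 2 hd01]
    exact (skewAdjoint M₂).zero_mem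
  · -- `hH₁r`
    intro ℓ hℓ
    rw [Set.mem_singleton_iff.1 hℓ, smul_apply, map_smul, rdL_embOf_c₀]
    exact real_smul_mem_skewAdjoint (hB (readOut7 0 (e r K)) (Set.mem_singleton _)) _
  · -- `hTr`: `TΦ V (cplx y)` is read skew-adjoint by leaf-03's letter
    intro ℓ hℓ
    rw [Set.mem_singleton_iff.1 hℓ, smul_apply, ContinuousLinearMap.coe_id', id, map_smul, readOut7_cplx]
    exact real_smul_mem_skewAdjoint (gen_mem_skewAdjoint _ _ _ _) _
  · -- `hRdict` (the `Sum.inr` leg's density is `toyF7`): `F(section x) = Jco V x · e^{−(0 + (0 + 0))}` on the cube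
    show toyF7 (0 : Fin toyParams.d → ℤ) h01 (S / 3) _ = _
    rw [toyJco7, indicator_of_mem hx]
    simp
  · -- `hudict`: leaf-03's dictionary READ THROUGH THE BLOCK SPACE (leaf-02's S104 f3 bullet, per run; file 1's lemmas)
    have hxS : ‖x‖ ≤ S :=
      mem_closedBall_zero_iff.1 (ShellMeasureLandauHolonomyPrint.chartCube_subset_closedBall hS.le hxu)
    have h𝔄 := norm_embOf_readOut7_cplx_lt 0 (e r K) (hη0 r) (hη1 r) (hSrη r) hxS
    have hsol : rdL 2 (cond r (1 : ℝ) (1 / 2)) (solAt (𝒢L 2 (cond r (1 : ℝ) (1 / 2)) (1 / (C₄c 2 + 1) * cond r (1 : ℝ) (1 / 2) / 2))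
        0 (blockW 2 (cond r (1 : ℝ) (1 / 2))) (tS toyParams.d toyParams.L / 32) (0 : 𝕎 2)
        (embOf 2 (cond r (1 : ℝ) (1 / 2)) (c₀ 2) (readOut7 0 (e r K)) (cplx x))) = 0 :=
      rdL_solAt_eq_zero 2 hd01 (h𝒢B r) (blockW_prop4Hyp 2 (by norm_num) (hη0 r) (hη1 r)) hB₀.le hC h𝔄 (by positivity)
        hdom' hself' hcontr'
    show toyU (p₀ (0 : Fin toyParams.d → ℤ) i₀ i₁ h01) _ = _
    rw [toyU, plaqHol_p₀_sec hN h01, dist1_eq_norm_coe_sub_one, coe_chart]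
    simp only [classifier, Finset.sup'_singleton, holOf_apply, List.map_cons, List.map_nil, wordExp_cons, wordExp_nil,
      mul_one, landauExp_zero, H₁η_TΦη_apply _ (hη0 r).ne' hC1.ne', map_add, hsol, zero_add, rdL_embOf_c₀, readOut7_cplx]
  · -- `hJW`
    by_contra h
    exact hJ (indicator_of_notMem h _)
  · -- `hJ`
    unfold toyJco7
    by_cases hx : x ∈ cube (m₀ r K) S
    · rw [indicator_of_mem hx, indicator_of_mem (smul_mem_cube hx ht')]
      exact toyF7_section_mono 0 h01 hN hSπ (e r K) (S / 3) V hx ht'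
    · rw [indicator_of_notMem hx]; exact bot_le
  · -- `hJ1`
    unfold toyJco7
    by_cases hx : x ∈ cube (m₀ r K) S
    · rw [indicator_of_mem hx]; exact toyF7_le_one 0 h01 (S / 3) _
    · rw [indicator_of_notMem hx]; exact bot_le

end Summit.QuantumFields.BalabanUV.T4Continuum.ShellMeasureLiveEndOneCallUnionLevelsCfLinToy

end
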